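import Summits.BirchSwinnertonDyer.BirchSwinnertonDyer.Theorems.AdditiveBranchIMCMultLowerBranchTransportClasses
import HarnessLib

/-!
# Route `AdditiveBranchIMC` (rung K1), crux `MultLower` (item `stmt-BirchSwinnertonDyer-19359`):
# the two displayed inputs of the branch transport on cell (M), NAMED (definitions; nothing asserted)

The branch transport (`AdditiveBranchIMCMultLowerBranchTransport{,Classes}.lean`, p419199/p419645)
derives the rational `ω^{(p−1)/2}`-branch main conjecture of the multiplicative twist
(`ChiBranchRatCharEqMult[Odd]At W p`) — hence, with one unit coefficient, the rank-`0` lower half on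
cell (M) (`…RankZero.lean`, `…RankZeroSkinner.lean`) — from two inputs displayed INLINE there. This
file gives them NAMES, so that the planner can file the open one as the cell's typed conjecture item and
consumers can cite it (D-0014: a prover does not file statement items; these are `def`s, nothing is
asserted, no universal closure is claimed):

* `MultTwistKatoTrivialBranchAt W p` — **(KV)**: for every globally minimal multiplicative twist model
  `V` of `W` (`C • V^{(p*)} = W`), newform `f` of `V` with `a_p(f) = ap`, cyclotomic datum and dual
  datum `DV` of `Sel_{p^∞}(V/ℚ_∞)`, at THE `p`-adic `L`-function `L` of `IsMultPAdicLFunctionOf f p ap`: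
  `∃ a, ∃ h ∈ char X(V/ℚ_∞)`, `ι(X^e·h) = p^a·L` (`e = 1` iff `V` split at `p`). IN PRINT on the
  (irr)+(ram) rows: Kato 2004 Thm. 17.4 / Skinner 2016 Thm. A (`katoV_of_skinner2016`,
  `…KatoTrivialBranch.lean`, given a rational period ratio of `f`).
* `MultTwistBaseChangeLowerAt W p` — **(BC)**: same data plus a dual datum `D` of `Sel_{p^∞}(W/ℚ_∞)`:
  `∃ m n G`, `ι(X^e·G) = p^n·L·L^±_p(f, ap, ω^{(p−1)/2}, T)` and
  `p^m·char X(V/ℚ_∞)·char X(W/ℚ_∞) ⊆ (G)` — the Burungale–Castella–Skinner (5.3)-shape product bound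
  for the pair `{V, W = V^{(p*)}}`, i.e. the descended form of the main-conjecture lower bound for `V`
  over the cyclotomic `ℤ_p`-extension of `K = ℚ(√p*)`, `p` RAMIFIED in `K`. NOT IN PRINT (Wan 2015:
  `p` unramified; Skinner–Urban 3.6.1/3.6.6, Wan `U(3,1)`: `p` split in the CM field; BCS Lemma 5.2.3
  chooses split/unramified fields; BSTW arXiv:2409.01350 Thm. 9.21 (c): `p ∤ 2N_g`, so the `χ`-branch is
  announced for GOOD `g` only). OPEN — the ONE Λ-level typed object of cell (M) in base-change currency.
* `chiBranchRatCharEqMult_of_multTwistKatoTrivialBranch_of_multTwistBaseChangeLower` — the class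
  theorem of p419645 restated with the names (X4(M) ∩ {ρ̄ onto}; definitional unfolding only).

References: Burungale–Castella–Skinner, IMRN 2025 Thm. 1.1.2 (a), §5 (5.3) [BurungaleCastellaSkinner2025];
Skinner, Pacific J. Math. 283 (2016) Thm. A, §3.2 [Skinner2016PacificMC]; Kato, Astérisque 295 (2004)
Thm. 17.4 [Kato2004Asterisque]; Mazur–Tate–Teitelbaum 1986 §I.10, §I.13–I.14 [MazurTateTeitelbaum1986Invent];
Wan, Algebra Number Theory 9 (2015) §1.1 [Wan2015HilbertIMC].
-/

set_option autoImplicit false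
set_option linter.dupNamespace false

noncomputable section

open scoped Classical MatrixGroups ModularForm

namespace Summit.BirchSwinnertonDyer.BirchSwinnertonDyer.Theorems.AdditiveBranchIMCMultLower

open CongruenceSubgroup WeierstrassCurve Literature.NumberTheory.EllipticCurves
  Literature.NumberTheory.EllipticCurves.ModularForms
  Literature.NumberTheory.EllipticCurves.Rank1Residual
  Summit.BirchSwinnertonDyer.Rank1Residual.Additive
  Summit.BirchSwinnertonDyer.Rank1Residual.AdditivePotMult

/-- **(KV), named: Kato's direction for the multiplicative twist models of `W` on the TRIVIAL branch,
rational, strict Selmer group** (`e = 1` iff the model is split at `p`), at THE `p`-adic `L`-function of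
`IsMultPAdicLFunctionOf`. A predicate on `(W, p)`; nothing asserted. In print on the (irr)+(ram) rows
(Kato 2004 Thm. 17.4; Skinner 2016 Thm. A §3.2 — tree: `katoV_of_skinner2016`).
[cite: Skinner2016PacificMC, Thm. A (§1), §3.2 (shape only; nothing asserted)]
[cite: Kato2004Asterisque, Thm. 17.4 (shape only; nothing asserted)] -/
def MultTwistKatoTrivialBranchAt (W : WeierstrassCurve ℚ) (p : ℕ) [Fact p.Prime] : Prop :=
  ∀ (V : WeierstrassCurve ℚ) [V.IsElliptic] [V.IsGloballyMinimal] (C : VariableChange ℚ),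
    Mult V p → C • V.quadraticTwist ((-1 : ℚ) ^ (p / 2) * p) = W →
    ∀ {N : ℕ} [NeZero N] (f : CuspForm (Gamma0 N) 2), IsNewformOf V f →
    ∀ (ap : ℤ), cuspCoeff f p = ap →
    ∀ (κ : ZpExtension ℚ p) (γ : Field.absoluteGaloisGroup ℚ),
      κ.IsCyclotomic → κ.IsTopGenerator γ → IsCyclotomicVariable p γ →
    ∀ (DV : V.SelmerDualData κ γ) (L : PowerSeries ℚ_[p]),
      IsMultPAdicLFunctionOf f p ((ap : ℤ) : ℚ_[p]) L →
      ∃ (a : ℕ) (h : IwasawaAlgebra p), h ∈ DV.charIdeal ∧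
        iwasawaToPowerSeries p
            (PowerSeries.X ^ (if V.HasSplitMultiplicativeReductionAtPrime p then 1 else 0) * h) =
          PowerSeries.C ((p : ℚ_[p]) ^ a) * L

/-- **(BC), named: the base-change product bound for the pair `{V, W = V^{(p*)}}`** — for every
multiplicative twist model, newform, cyclotomic datum and dual data `DV`/`D`, at THE `p`-adic
`L`-function `L` of `V`: `∃ m n G`, `ι(X^e·G) = p^n·L·L^±_br` and `p^m·char X(V/ℚ_∞)·char X(W/ℚ_∞) ⊆ (G)`
(Burungale–Castella–Skinner (5.3) shape; the descended form of `char X(V/K·ℚ_∞) ⊆ (L_p(V/K))`,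
`K = ℚ(√p*)`, `p` RAMIFIED in `K`). A predicate on `(W, p)`; OPEN — NOT in print at any pair; its
universal closure is NOT asserted. [cite: BurungaleCastellaSkinner2025, §5 (5.3) (shape only; nothing asserted)]
[cite: MazurTateTeitelbaum1986Invent, §I.10, §I.13–I.14 (the branch series; shape)] -/
def MultTwistBaseChangeLowerAt (W : WeierstrassCurve ℚ) (p : ℕ) [Fact p.Prime] : Prop :=
  ∀ (V : WeierstrassCurve ℚ) [V.IsElliptic] [V.IsGloballyMinimal] (C : VariableChange ℚ),
    Mult V p → C • V.quadraticTwist ((-1 : ℚ) ^ (p / 2) * p) = W →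
    ∀ {N : ℕ} [NeZero N] (f : CuspForm (Gamma0 N) 2), IsNewformOf V f →
    ∀ (ap : ℤ), cuspCoeff f p = ap →
    ∀ (κ : ZpExtension ℚ p) (γ : Field.absoluteGaloisGroup ℚ),
      κ.IsCyclotomic → κ.IsTopGenerator γ → IsCyclotomicVariable p γ →
    ∀ (DV : V.SelmerDualData κ γ) (D : W.SelmerDualData κ γ) (L : PowerSeries ℚ_[p]),
      IsMultPAdicLFunctionOf f p ((ap : ℤ) : ℚ_[p]) L →
      ∃ (m n : ℕ) (G : IwasawaAlgebra p),
        iwasawaToPowerSeries p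
            (PowerSeries.X ^ (if V.HasSplitMultiplicativeReductionAtPrime p then 1 else 0) * G) =
          PowerSeries.C ((p : ℚ_[p]) ^ n) *
            (L * (if Even (p / 2) then padicLFunctionPlusBranchMult f ((ap : ℤ) : ℚ_[p]) (p / 2)
              else padicLFunctionMinusBranchMult f ((ap : ℤ) : ℚ_[p]) (p / 2))) ∧
        ∀ x ∈ DV.charIdeal, ∀ y ∈ D.charIdeal,
          PowerSeries.C ((p : ℤ_[p]) ^ m) * (x * y) ∈ Ideal.span {G}

variable (p : ℕ) [hp : Fact p.Prime]

/-- Unfolding lemma for `MultTwistKatoTrivialBranchAt`. -/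
theorem multTwistKatoTrivialBranchAt_iff (W : WeierstrassCurve ℚ) :
    MultTwistKatoTrivialBranchAt W p ↔
      ∀ (V : WeierstrassCurve ℚ) [V.IsElliptic] [V.IsGloballyMinimal] (C : VariableChange ℚ),
      Mult V p → C • V.quadraticTwist ((-1 : ℚ) ^ (p / 2) * p) = W →
      ∀ {N : ℕ} [NeZero N] (f : CuspForm (Gamma0 N) 2), IsNewformOf V f →
      ∀ (ap : ℤ), cuspCoeff f p = ap →
      ∀ (κ : ZpExtension ℚ p) (γ : Field.absoluteGaloisGroup ℚ),
        κ.IsCyclotomic → κ.IsTopGenerator γ → IsCyclotomicVariable p γ →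
      ∀ (DV : V.SelmerDualData κ γ) (L : PowerSeries ℚ_[p]),
        IsMultPAdicLFunctionOf f p ((ap : ℤ) : ℚ_[p]) L →
        ∃ (a : ℕ) (h : IwasawaAlgebra p), h ∈ DV.charIdeal ∧
          iwasawaToPowerSeries p
              (PowerSeries.X ^ (if V.HasSplitMultiplicativeReductionAtPrime p then 1 else 0) * h) =
            PowerSeries.C ((p : ℚ_[p]) ^ a) * L :=
  Iff.rfl

/-- Unfolding lemma for `MultTwistBaseChangeLowerAt`. -/
theorem multTwistBaseChangeLowerAt_iff (W : WeierstrassCurve ℚ) :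
    MultTwistBaseChangeLowerAt W p ↔
      ∀ (V : WeierstrassCurve ℚ) [V.IsElliptic] [V.IsGloballyMinimal] (C : VariableChange ℚ),
      Mult V p → C • V.quadraticTwist ((-1 : ℚ) ^ (p / 2) * p) = W →
      ∀ {N : ℕ} [NeZero N] (f : CuspForm (Gamma0 N) 2), IsNewformOf V f →
      ∀ (ap : ℤ), cuspCoeff f p = ap →
      ∀ (κ : ZpExtension ℚ p) (γ : Field.absoluteGaloisGroup ℚ),
        κ.IsCyclotomic → κ.IsTopGenerator γ → IsCyclotomicVariable p γ →
      ∀ (DV : V.SelmerDualData κ γ) (D : W.SelmerDualData κ γ) (L : PowerSeries ℚ_[p]),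
        IsMultPAdicLFunctionOf f p ((ap : ℤ) : ℚ_[p]) L →
        ∃ (m n : ℕ) (G : IwasawaAlgebra p),
          iwasawaToPowerSeries p
              (PowerSeries.X ^ (if V.HasSplitMultiplicativeReductionAtPrime p then 1 else 0) * G) =
            PowerSeries.C ((p : ℚ_[p]) ^ n) *
              (L * (if Even (p / 2) then padicLFunctionPlusBranchMult f ((ap : ℤ) : ℚ_[p]) (p / 2)
                else padicLFunctionMinusBranchMult f ((ap : ℤ) : ℚ_[p]) (p / 2))) ∧
          ∀ x ∈ DV.charIdeal, ∀ y ∈ D.charIdeal,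
            PowerSeries.C ((p : ℤ_[p]) ^ m) * (x * y) ∈ Ideal.span {G} :=
  Iff.rfl

/-- **X4(M) ∩ {ρ̄ onto}, every odd `p`: (KV) ∧ (BC), NAMED, give the rational `χ`-branch main conjecture
of the multiplicative twist** — p419645's `ClassX4M.chiBranchRatCharEqMult_of_katoV_of_baseChangeLower`
with the names (Kato 17.4 (3) reading `hK` BY NAME). [cite: Kato2004Asterisque, Thm. 17.4 (3) (p. 273)]
[cite: BurungaleCastellaSkinner2025, Thm. 1.1.2 (a) (shape)] -/
theorem chiBranchRatCharEqMult_of_multTwistKatoTrivialBranch_of_multTwistBaseChangeLower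
    {W : WeierstrassCurve ℚ} [W.IsElliptic] [W.IsGloballyMinimal]
    (hK : Wuthrich2014.kato_halfEigenCharIdeal_dvd_cyclotomicPrime_of_surjective)
    (hX : ClassX4M W p) (hsurj : Surj W p) (hKV : MultTwistKatoTrivialBranchAt W p)
    (hBC : MultTwistBaseChangeLowerAt W p) :
    (p % 4 = 1 → ChiBranchRatCharEqMultAt W p) ∧ (p % 4 = 3 → ChiBranchRatCharEqMultOddAt W p) :=
  ClassX4M.chiBranchRatCharEqMult_of_katoV_of_baseChangeLower p hK hX hsurj hKV hBC

/-- **X3♯(M), every odd `p`: the same with Wuthrich 2014 Thm. 16 (`hW16`) BY NAME.**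
[cite: Wuthrich2014, Thm. 16 (p. 397)] [cite: BurungaleCastellaSkinner2025, Thm. 1.1.2 (a) (shape)] -/
theorem chiBranchRatCharEqMult_of_multTwistKatoTrivialBranch_of_multTwistBaseChangeLower_X3
    {W : WeierstrassCurve ℚ} [W.IsElliptic] [W.IsGloballyMinimal]
    (hW16 : Wuthrich2014.thm16_halfEigenCharIdeal_dvd_cyclotomicPrime)
    (hX : ClassX3M W p) (hKV : MultTwistKatoTrivialBranchAt W p)
    (hBC : MultTwistBaseChangeLowerAt W p) :
    (p % 4 = 1 → ChiBranchRatCharEqMultAt W p) ∧ (p % 4 = 3 → ChiBranchRatCharEqMultOddAt W p) :=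
  ClassX3M.chiBranchRatCharEqMult_of_katoV_of_baseChangeLower p hW16 hX hKV hBC

end Summit.BirchSwinnertonDyer.BirchSwinnertonDyer.Theorems.AdditiveBranchIMCMultLower

end
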